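import Summits.QuantumFields.YangMills.Theses.CovariantDischarge
import Summits.QuantumFields.YangMills.Theorems.UnitScaleTiltHistoryTailLOfFirstExitTail
import Literature.MathematicalPhysics.QuantumFieldTheory.Balaban1983to89.T3YM3TorusStatement

/-!
# LINE `covariant_discharge` on crux stmt-QuantumFields-19936 `UnitScaleTilt.HistoryTailL`
(ideator seat ym-r3-idea-2, g6, lens «nearmiss»; route `CovariantDischarge`).

Skeleton: four registered stubs — the route's three depth ranges of the first-exit WINDOW tail
(level one · bounded depth · a positive FRACTION of the depth · the deep residual) — and the kernel-checked
compositions `FractionalWindowTailL_of` (BC3 skeleton of the deciding crux) and `HistoryTailL_of`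
(concludes the crux BY NAME).  Mechanism of the first three stubs: the Haar-exact covariant
Cameron–Martin sweep (see `Lines/covariant_discharge.md`).  `stub_deepWindow` is organ-class (residual;
implied verbatim by route FirstExitWindow's crux stmt-26243).  No summit and no rung is proved here.
@sorry-status: sorries ONLY inside `stub_*`.
-/

namespace Summit.QuantumFields.YangMills.Cruxes.HistoryTailL.CovariantDischarge

open scoped BigOperators Topology Classical MeasureTheory
open Filter Set Function MeasureTheory

/-- STUB 1 (rung; size L): the window tail at level `j = 1`, every cut-off `K ≥ 1` — one covariant sweep with
tree frames of radius `p·p_K·L^(3/2)`; deterministic defect budget `p² p_K³ L³/√β_K ≤ 1`. -/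
theorem stub_levelOne : Summit.QuantumFields.YangMills.Theses.CovariantDischarge.LevelOneWindowTailL := by
  sorry

/-- STUB 2 (rung family; size L): the window tail at BOUNDED depth `2 ≤ j ≤ j₀`, every `K ≥ j`, constants
depending on `j₀` — the same sweep, tree frames of radius `p·p_K·L^(3j₀/2)`. -/
theorem stub_boundedDepth :
    open Literature.MathematicalPhysics.QuantumFieldTheory.Balaban1983to89 Literature.MathematicalPhysics.QuantumFieldTheory.Balaban1983to89.T3ContinuumYM3Torus in ∀ (L j₀ : ℕ), ∀ (b₀ p₀ b₂ : ℝ), 0 < b₀ → 2 < p₀ → b₀ ≤ b₂ → ∃ (γ₁ C c : ℝ) (N : ℕ), 0 < γ₁ ∧ γ₁ ≤ 1 ∧ 0 < c ∧ ∀ (F : T3Family) (γ : ℝ), F.L = L → 0 < γ → γ ≤ γ₁ → ∀ (K j : ℕ), 2 ≤ j → j ≤ j₀ → j ≤ K → ∀ p : Plaq (F.P K) j, (T3UnitScaleTilt.gibbsK F T3UnitLawDensityEML.ℰp γ K).real {U | (∀ k, k < j → PlaqSmall (T3UnitScaleTilt.θBal F.L γ b₀ p₀ (K - k)) (Averaging.iter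 (fun i => BlockAveraging.blockAvg (P := F.P K) (j := i) T3UnitLawDensityEML.ℰp) k U)) ∧ PlaqSmall (T3UnitScaleTilt.θBal F.L γ b₂ p₀ (K - j)) (Averaging.iter (fun i => BlockAveraging.blockAvg (P := F.P K) (j := i) T3UnitLawDensityEML.ℰp) j U) ∧ T3UnitScaleTilt.θBal F.L γ b₀ p₀ (K - j) ≤ GaugeGroup.dist1 (GaugeField.plaqHol (Averaging.iter (fun i => BlockAveraging.blockAvg (P := F.P K) (j := i) T3UnitLawDensityEML.ℰp) j U) p)} ≤ C * ((γ * ((F.L : ℝ)⁻¹) ^ (K - j))⁻¹) ^ N * Real.exp (-(c * B10.pFun b₀ p₀ (Real.sqrt (γ * ((F.L : ℝ)⁻¹) ^ (K - j))) ^ 2)) := by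
  sorry

/-- STUB 3 (HARDEST; size XL): the window tail on a positive FRACTION of the depth, `j₀ < j`, `N₁·j ≤ K`
for SOME `j₀, N₁` — covariant sweep with frames of controlled growth; the deterministic frame-defect sum
`β_K‖da‖₁·M·θ_K` must stay `≤ 1`, which the budget gives for `N₁ ≥ 7` (tree frames) / `N₁ ≥ 4` (covariant). -/
theorem stub_unboundedDepth :
    open Literature.MathematicalPhysics.QuantumFieldTheory.Balaban1983to89 Literature.MathematicalPhysics.QuantumFieldTheory.Balaban1983to89.T3ContinuumYM3Torus in ∀ (L : ℕ), ∃ (j₀ N₁ : ℕ), 0 < N₁ ∧ ∀ (b₀ p₀ b₂ : ℝ), 0 < b₀ → 2 < p₀ → b₀ ≤ b₂ → ∃ (γ₁ C c : ℝ) (N : ℕ), 0 < γ₁ ∧ γ₁ ≤ 1 ∧ 0 < c ∧ ∀ (F : T3Family) (γ : ℝ), F.L = L → 0 < γ → γ ≤ γ₁ → ∀ (K j : ℕ), j₀ < j → N₁ * j ≤ K → ∀ p : Plaq (F.P K) j, (T3UnitScaleTilt.gibbsK F T3UnitLawDensityEML.ℰp γ K).real {U | (∀ k, k < j → PlaqSmall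 (T3UnitScaleTilt.θBal F.L γ b₀ p₀ (K - k)) (Averaging.iter (fun i => BlockAveraging.blockAvg (P := F.P K) (j := i) T3UnitLawDensityEML.ℰp) k U)) ∧ PlaqSmall (T3UnitScaleTilt.θBal F.L γ b₂ p₀ (K - j)) (Averaging.iter (fun i => BlockAveraging.blockAvg (P := F.P K) (j := i) T3UnitLawDensityEML.ℰp) j U) ∧ T3UnitScaleTilt.θBal F.L γ b₀ p₀ (K - j) ≤ GaugeGroup.dist1 (GaugeField.plaqHol (Averaging.iter (fun i => BlockAveraging.blockAvg (P := F.P K) (j := i) T3UnitLawDensityEML.ℰp) j U) p)} ≤ C * ((γ * ((F.L : ℝ)⁻¹) ^ (K - j))⁻¹) ^ N * Real.exp (-(c * B10.pFun b₀ p₀ (Real.sqrt (γ * ((F.L : ℝ)⁻¹) ^ (K - j))) ^ 2)) := by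
  sorry

/-- STUB 4 (RESIDUAL, organ-class; size open-problem): the deep range `K < N₁·j` — verbatim a restriction of
route FirstExitWindow's crux `FirstExitWindowTailL` (stmt-26243); NOT attacked by the sweep. -/
theorem stub_deepWindow : Summit.QuantumFields.YangMills.Theses.CovariantDischarge.DeepWindowTailL := by
  sorry

section Compositions

open Literature.MathematicalPhysics.QuantumFieldTheory.Balaban1983to89
open Literature.MathematicalPhysics.QuantumFieldTheory.Balaban1983to89.T3ContinuumYM3Torus

/-- Monotonicity of the schema bound in its constants (`1 ≤ β`, `0 ≤ t`). [folklore] -/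
private theorem schema_mono {x Cx C β cx c t : ℝ} {Nx N : ℕ} (hβ : 1 ≤ β) (hN : Nx ≤ N) (hc : c ≤ cx)
    (ht : 0 ≤ t) (hCx : |Cx| ≤ C) (h : x ≤ Cx * β ^ Nx * Real.exp (-(cx * t))) :
    x ≤ C * β ^ N * Real.exp (-(c * t)) := by
  have hβ0 : 0 ≤ β := zero_le_one.trans hβ
  have h1 : Cx * β ^ Nx * Real.exp (-(cx * t)) ≤ |Cx| * β ^ Nx * Real.exp (-(cx * t)) :=
    mul_le_mul_of_nonneg_right (mul_le_mul_of_nonneg_right (le_abs_self Cx) (pow_nonneg hβ0 Nx))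
      (Real.exp_nonneg _)
  have h2 : |Cx| * β ^ Nx * Real.exp (-(cx * t)) ≤ C * β ^ N * Real.exp (-(c * t)) := by
    have hC0 : 0 ≤ C := (abs_nonneg Cx).trans hCx
    have hpow : β ^ Nx ≤ β ^ N := pow_le_pow_right₀ hβ hN
    have hexp : Real.exp (-(cx * t)) ≤ Real.exp (-(c * t)) :=
      Real.exp_le_exp.mpr (neg_le_neg (mul_le_mul_of_nonneg_right hc ht))
    calc |Cx| * β ^ Nx * Real.exp (-(cx * t)) ≤ C * β ^ N * Real.exp (-(cx * t)) :=
          mul_le_mul_of_nonneg_right (mul_le_mul hCx hpow (pow_nonneg hβ0 Nx) hC0) (Real.exp_nonneg _)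
      _ ≤ C * β ^ N * Real.exp (-(c * t)) :=
          mul_le_mul_of_nonneg_left hexp (mul_nonneg hC0 (pow_nonneg hβ0 N))
  exact h.trans (h1.trans h2)

/-- `1 ≤ β_(K−j) = (γ L^{-(K−j)})⁻¹` on a Bałaban family when `γ ≤ 1`. [folklore] -/
private theorem one_le_beta (F : T3Family) {γ : ℝ} (hγ : 0 < γ) (hγ1 : γ ≤ 1) (K j : ℕ) :
    (1 : ℝ) ≤ (γ * ((F.L : ℝ)⁻¹) ^ (K - j))⁻¹ := by
  have hL1 : (1 : ℝ) ≤ F.L := by exact_mod_cast F.hL.2.le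
  have hL0 : (0 : ℝ) < F.L := one_pos.trans_le hL1
  have hq0 : 0 < γ * ((F.L : ℝ)⁻¹) ^ (K - j) := mul_pos hγ (pow_pos (inv_pos.mpr hL0) _)
  have hq1 : γ * ((F.L : ℝ)⁻¹) ^ (K - j) ≤ 1 := by
    have h1 : ((F.L : ℝ)⁻¹) ^ (K - j) ≤ 1 := pow_le_one₀ (inv_nonneg.mpr hL0.le) (inv_le_one_of_one_le₀ hL1)
    calc γ * ((F.L : ℝ)⁻¹) ^ (K - j) ≤ 1 * 1 := mul_le_mul hγ1 h1 (pow_nonneg (inv_nonneg.mpr hL0.le) _) zero_le_one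
      _ = 1 := one_mul 1
  exact (one_le_inv₀ hq0).mpr hq1

/-- BC3 composition of the DECIDING crux: bounded depth + a fraction beyond `j₀` give the fractional
window tail (pure logic + `schema_mono`). -/
theorem FractionalWindowTailL_of
    (hB : open Literature.MathematicalPhysics.QuantumFieldTheory.Balaban1983to89 Literature.MathematicalPhysics.QuantumFieldTheory.Balaban1983to89.T3ContinuumYM3Torus in ∀ (L j₀ : ℕ), ∀ (b₀ p₀ b₂ : ℝ), 0 < b₀ → 2 < p₀ → b₀ ≤ b₂ → ∃ (γ₁ C c : ℝ) (N : ℕ), 0 < γ₁ ∧ γ₁ ≤ 1 ∧ 0 < c ∧ ∀ (F : T3Family) (γ : ℝ), F.L = L → 0 < γ → γ ≤ γ₁ → ∀ (K j : ℕ), 2 ≤ j → j ≤ j₀ → j ≤ K → ∀ p : Plaq (F.P K) j, (T3UnitScaleTilt.gibbsK F T3UnitLawDensityEML.ℰp γ K).real {U | (∀ k, k < j → PlaqSmall (T3UnitScaleTilt.θBal F.L γ b₀ p₀ (K - k)) (Averaging.iter (fun i => BlockAveraging.blockAvg (P := F.P K) (j := i) T3UnitLawDensityEML.ℰp) k U))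 ∧ PlaqSmall (T3UnitScaleTilt.θBal F.L γ b₂ p₀ (K - j)) (Averaging.iter (fun i => BlockAveraging.blockAvg (P := F.P K) (j := i) T3UnitLawDensityEML.ℰp) j U) ∧ T3UnitScaleTilt.θBal F.L γ b₀ p₀ (K - j) ≤ GaugeGroup.dist1 (GaugeField.plaqHol (Averaging.iter (fun i => BlockAveraging.blockAvg (P := F.P K) (j := i) T3UnitLawDensityEML.ℰp) j U) p)} ≤ C * ((γ * ((F.L : ℝ)⁻¹) ^ (K - j))⁻¹) ^ N * Real.exp (-(c * B10.pFun b₀ p₀ (Real.sqrt (γ * ((F.L : ℝ)⁻¹) ^ (K - j))) ^ 2)))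
    (hU : open Literature.MathematicalPhysics.QuantumFieldTheory.Balaban1983to89 Literature.MathematicalPhysics.QuantumFieldTheory.Balaban1983to89.T3ContinuumYM3Torus in ∀ (L : ℕ), ∃ (j₀ N₁ : ℕ), 0 < N₁ ∧ ∀ (b₀ p₀ b₂ : ℝ), 0 < b₀ → 2 < p₀ → b₀ ≤ b₂ → ∃ (γ₁ C c : ℝ) (N : ℕ), 0 < γ₁ ∧ γ₁ ≤ 1 ∧ 0 < c ∧ ∀ (F : T3Family) (γ : ℝ), F.L = L → 0 < γ → γ ≤ γ₁ → ∀ (K j : ℕ), j₀ < j → N₁ * j ≤ K → ∀ p : Plaq (F.P K) j, (T3UnitScaleTilt.gibbsK F T3UnitLawDensityEML.ℰp γ K).real {U | (∀ k, k < j → PlaqSmall (T3UnitScaleTilt.θBal F.L γ b₀ p₀ (K - k)) (Averaging.iter (fun i => BlockAveraging.blockAvg (P := F.P K) (j := i) T3UnitLawDensityEML.ℰp) k U)) ∧ PlaqSmall (T3UnitScaleTilt.θBal F.L γ b₂ p₀ (K - j)) (Averaging.iter (fun i => BlockAveraging.blockAvg (P := F.P K) (j := i) T3UnitLawDensityEML.ℰp)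 j U) ∧ T3UnitScaleTilt.θBal F.L γ b₀ p₀ (K - j) ≤ GaugeGroup.dist1 (GaugeField.plaqHol (Averaging.iter (fun i => BlockAveraging.blockAvg (P := F.P K) (j := i) T3UnitLawDensityEML.ℰp) j U) p)} ≤ C * ((γ * ((F.L : ℝ)⁻¹) ^ (K - j))⁻¹) ^ N * Real.exp (-(c * B10.pFun b₀ p₀ (Real.sqrt (γ * ((F.L : ℝ)⁻¹) ^ (K - j))) ^ 2))) :
    Summit.QuantumFields.YangMills.Theses.CovariantDischarge.FractionalWindowTailL := by
  intro L
  obtain ⟨j₀, N₁, hN₁, hU'⟩ := hU L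
  refine ⟨N₁, hN₁, ?_⟩
  intro b₀ p₀ b₂ hb₀ hp₀ hb₂
  obtain ⟨γa, Ca, ca, Na, hγa, hγa1, hca, hA⟩ := hB L j₀ b₀ p₀ b₂ hb₀ hp₀ hb₂
  obtain ⟨γb, Cb, cb, Nb, hγb, hγb1, hcb, hB'⟩ := hU' b₀ p₀ b₂ hb₀ hp₀ hb₂
  refine ⟨min γa γb, |Ca| + |Cb|, min ca cb, Na + Nb, lt_min hγa hγb, (min_le_left _ _).trans hγa1,
    lt_min hca hcb, ?_⟩
  intro F γ hFL hγ hγ1 K j hj2 hN p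
  have hγa' : γ ≤ γa := hγ1.trans (min_le_left _ _)
  have hγb' : γ ≤ γb := hγ1.trans (min_le_right _ _)
  have hβ := one_le_beta F hγ (hγa'.trans hγa1) K j
  have ht : (0 : ℝ) ≤ B10.pFun b₀ p₀ (Real.sqrt (γ * ((F.L : ℝ)⁻¹) ^ (K - j))) ^ 2 := sq_nonneg _
  have hCa : |Ca| ≤ |Ca| + |Cb| := by linarith [abs_nonneg Cb]
  have hCb : |Cb| ≤ |Ca| + |Cb| := by linarith [abs_nonneg Ca]
  have hjN : j ≤ N₁ * j := Nat.le_mul_of_pos_left j hN₁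
  by_cases hj : j ≤ j₀
  · exact schema_mono hβ (by omega) (min_le_left _ _) ht hCa (hA F γ hFL hγ hγa' K j hj2 hj (by omega) p)
  · exact schema_mono hβ (by omega) (min_le_right _ _) ht hCb (hB' F γ hFL hγ hγb' K j (by omega) hN p)

/-- The three ranges recombine to route FirstExitWindow's crux `FirstExitWindowTailL` (stmt-26243). -/
theorem firstExitWindowTailL_of_ranges (h1 : Summit.QuantumFields.YangMills.Theses.CovariantDischarge.LevelOneWindowTailL)
    (hF : Summit.QuantumFields.YangMills.Theses.CovariantDischarge.FractionalWindowTailL) (hD : Summit.QuantumFields.YangMills.Theses.CovariantDischarge.DeepWindowTailL) :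
    Summit.QuantumFields.YangMills.Theses.FirstExitWindow.FirstExitWindowTailL := by
  intro L b₀ p₀ b₂ hb₀ hp₀ hb₂
  obtain ⟨N₁, hN₁, hF'⟩ := hF L
  obtain ⟨γa, Ca, ca, Na, hγa, hγa1, hca, hA⟩ := h1 L b₀ p₀ b₂ hb₀ hp₀ hb₂
  obtain ⟨γb, Cb, cb, Nb, hγb, hγb1, hcb, hB⟩ := hF' b₀ p₀ b₂ hb₀ hp₀ hb₂
  obtain ⟨γc, Cc, cc, Nc, hγc, hγc1, hcc, hC⟩ := hD L N₁ hN₁ b₀ p₀ b₂ hb₀ hp₀ hb₂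
  refine ⟨min γa (min γb γc), |Ca| + |Cb| + |Cc|, min ca (min cb cc), Na + Nb + Nc,
    lt_min hγa (lt_min hγb hγc), (min_le_left _ _).trans hγa1, lt_min hca (lt_min hcb hcc), ?_⟩
  intro F γ hFL hγ hγ1 K j hj1 hjK p
  have hγa' : γ ≤ γa := hγ1.trans (min_le_left _ _)
  have hγb' : γ ≤ γb := hγ1.trans ((min_le_right _ _).trans (min_le_left _ _))
  have hγc' : γ ≤ γc := hγ1.trans ((min_le_right _ _).trans (min_le_right _ _))
  have hβ := one_le_beta F hγ (hγa'.trans hγa1) K j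
  have ht : (0 : ℝ) ≤ B10.pFun b₀ p₀ (Real.sqrt (γ * ((F.L : ℝ)⁻¹) ^ (K - j))) ^ 2 := sq_nonneg _
  have hCa : |Ca| ≤ |Ca| + |Cb| + |Cc| := by linarith [abs_nonneg Cb, abs_nonneg Cc]
  have hCb : |Cb| ≤ |Ca| + |Cb| + |Cc| := by linarith [abs_nonneg Ca, abs_nonneg Cc]
  have hCc : |Cc| ≤ |Ca| + |Cb| + |Cc| := by linarith [abs_nonneg Ca, abs_nonneg Cb]
  by_cases hj : j = 1
  · exact schema_mono hβ (by omega) (min_le_left _ _) ht hCa (hA F γ hFL hγ hγa' K j hj (by omega) p)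
  · by_cases hr : N₁ * j ≤ K
    · exact schema_mono hβ (by omega) ((min_le_right _ _).trans (min_le_left _ _)) ht hCb
        (hB F γ hFL hγ hγb' K j (by omega) hr p)
    · exact schema_mono hβ (by omega) ((min_le_right _ _).trans (min_le_right _ _)) ht hCc
        (hC F γ hFL hγ hγc' K j hj1 hjK (by omega) p)

/-- BC3 link: the two depth stubs give the deciding crux `FractionalWindowTailL` (stmt-QuantumFields-22891) by name. -/
theorem FractionalWindowTailL_of_stubs : Summit.QuantumFields.YangMills.Theses.CovariantDischarge.FractionalWindowTailL :=
  FractionalWindowTailL_of stub_boundedDepth stub_unboundedDepth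

/-- THE LINE'S COMPOSITION: the crux `UnitScaleTilt.HistoryTailL` (stmt-QuantumFields-19936) BY NAME from the route's registered
items `LevelOneWindowTailL` (stmt-22894) and `DeepWindowTailL` (stmt-22892) as hypotheses and the depth stubs `stub_boundedDepth`,
`stub_unboundedDepth` by name (via the landed `unitScaleTilt_historyTailL_of_firstExitWindowTailL`). -/
theorem HistoryTailL_of
    (h1 : Summit.QuantumFields.YangMills.Theses.CovariantDischarge.LevelOneWindowTailL)
    (hD : Summit.QuantumFields.YangMills.Theses.CovariantDischarge.DeepWindowTailL) :
    Summit.QuantumFields.YangMills.Theses.UnitScaleTilt.HistoryTailL :=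
  Summit.QuantumFields.YangMills.Theorems.unitScaleTilt_historyTailL_of_firstExitWindowTailL
    (firstExitWindowTailL_of_ranges h1 (FractionalWindowTailL_of stub_boundedDepth stub_unboundedDepth) hD)

/-- All-stubs form (no hypotheses): the four stubs give the crux. -/
theorem HistoryTailL_of_stubs : Summit.QuantumFields.YangMills.Theses.UnitScaleTilt.HistoryTailL :=
  HistoryTailL_of stub_levelOne stub_deepWindow

end Compositions

end Summit.QuantumFields.YangMills.Cruxes.HistoryTailL.CovariantDischarge
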